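import Literature.NumberTheory.Rogawski1990.LocalTransferExplicitNonsplit
import Literature.NumberTheory.Rogawski1990.LocalTransferGlueCM                     -- ★ `classOrbitalIntegral_add_of_isLocSmooth_of_delta_ne_zero`, `finite_support_delta_mul_classOrbitalIntegral_of_isLocSmooth`
import Literature.NumberTheory.Automorphic.OrbitalMeasureCanonical                  -- ★ `OrbitalMeasureFamily.IsCanonical.isAdmissibleOn`
import Literature.NumberTheory.Rogawski1990.LocalTransferGlueNhdsOne
import Literature.NumberTheory.Rogawski1990.FinExplicitTransferFactorConjLeft        -- ★ `finExplicitDelta_conj_left_all`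
import Literature.NumberTheory.Rogawski1990.FinExplicitTransferFactorConjRight       -- ★ `finExplicitDelta_conj_right_all`
import Literature.NumberTheory.Rogawski1990.LocalTransferRegularCutoff               -- ★ `classOrbitalIntegral_congr_of_forall_conj`
import Literature.NumberTheory.Rogawski1990.RankOneEulerPoincareGlue                 -- ★ `IsLocSmooth.sub`
import Literature.NumberTheory.Rogawski1990.U3SupercuspidalJacquetVanishing          -- ★ `coe_localNonsplitEquiv_apply` (rfl)
import Literature.NumberTheory.Automorphic.UnitaryLevelOnePieceOfStrata              -- ★ p846532 F0P2-p01 (g14): `exists_levelOne_piece_boundary` (the piece `h`)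
import Literature.NumberTheory.Automorphic.ResiduallyUnipotentFixedCosetCount        -- ★ `isNilpotent_redMat_conj_sub_one_of_charpoly`
import Literature.NumberTheory.Automorphic.ResiduallyTrivialFixedCosetCount          -- ★ ROW-0 bridge `rank_redMat_sub_one_eq_zero_iff_forall_valuation_le`
import Literature.NumberTheory.Automorphic.UnitaryDepthZeroPieceOrbitalIntegral      -- ★ `rank_lt_of_isNilpotent`
import Literature.NumberTheory.Automorphic.UnitaryLatticeTreeCharpolyCongruence      -- ★ `v_inv_mul_charpoly_coeff_sub_le_one`
import Literature.NumberTheory.Automorphic.UnitaryLatticeTreeLevelShiftClass         -- ★ `isIntMatrix_one`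
import Literature.NumberTheory.Automorphic.LocalUnitaryIntegralLevel                 -- ★ `mem_localIntegralLevel_iff_of_smul_eq`
import Literature.NumberTheory.Automorphic.ValuedFieldValuativeRelBridge             -- ★ `isUniformizingElement_of_v_eq`, `v_le_iff_valuation_le`
import Literature.NumberTheory.Automorphic.Liu2021.LemD1AsPrintedIndexedNonVacuityInertCofinite  -- ★ `valued_toPlace_uniformizer_of_isUnramifiedIn`
import Literature.GroupTheory.SpecificGroups.FiniteUnitaryThreeUnipotentJordanClasses -- ★ `isNilpotent_iff_pow_three_eq_zero`
import HarnessLib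

/-!
# The LIFT's boundary split (organ B — Rogawski §4.9 Prop. 4.9.1, one hyperspecial level up)

Let `L∕L⁺` be CM, `v` inert and unramified in `L` (`w ∣ v`), `H′_w` unimodular, `G′_v = U(H′)(L⁺_v)`, `K = U(H′)(𝒪_v)`.  For a level-2
`K`-class piece `g` with boundary values `c` (organ V, ★ `exists_boundaryValues_of_levelTwo`: `g = c 1` on residual transvections of
`K` conjugate into `K(2)`, `g = c 2` on residually regular unipotents conjugate into `K(2)`, `c 0 = 0`) let `h` be the level-1 strata
piece with values `c` (★ `exists_levelOne_piece_boundary`) and `g_int = 1_{x_w ≡ 1 (ϖ_v)} · g` the interior part.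

**Main results.**
* `sub_apply_eq_indicator_apply_of_two_deep` — pointwise: on the `G′_v`-class of a 2-deep `γ₀` (`γ₀,w ≡ 1 (ϖ_v²)`), `g − h = g_int`
  (off `K` everything vanishes; on `K` the class is residually unipotent — `χ_{γ₀} ≡ (X−1)³ (𝔪_w)`, ★ `v_inv_mul_charpoly_coeff_sub_le_one`,
  ★ `isNilpotent_redMat_conj_sub_one_of_charpoly` — and the Jordan rank `0 ∕ 1 ∕ 2` of `red(z_w) − 1` decides: rank `0` is the interior
  (★ ROW-0 bridge), ranks `1, 2` are the two boundary strata where `g = c s = h`).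
* `liftBoundary_of_levelTwo` — ORGAN B in the END's tokens: `∃ h` (the five piece properties) and, for `G`-regular `γ_H` and the hypothesis
  (H2D) «every `Δ‴(γ_H, ·)`-support class meeting `K` contains a 2-deep `γ₀ ∈ K`», the split
  `Σᶠ_c Δ‴(γ_H,c)·Φ(c,g) = Σᶠ_c Δ‴(γ_H,c)·Φ(c,g_int) + Σᶠ_c Δ‴(γ_H,c)·Φ(c,h)` (orbit-wise congruence ★ `classOrbitalIntegral_congr_of_forall_conj`,
  additivity at regular classes ★ `classOrbitalIntegral_add_of_isLocSmooth_of_delta_ne_zero`, finite support ★).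

The print: [Rogawski1990] §4.9 Prop. 4.9.1 p. 55 (germs of orbital integrals of `K`-bi-invariant functions near `1` are governed by the
unipotent classes), §4.3 (4.3.1) p. 43, §3.9 p. 32; [Kottwitz1986] §3 (reduction to residually unipotent classes); [Tits1979] §3.5.

## References
* [Rogawski1990] J. Rogawski, *Automorphic Representations of Unitary Groups in Three Variables*, Ann. of Math. Stud. 123 (1990),
  §4.9 Prop. 4.9.1 p. 55; §4.3 p. 43; §3.9 p. 32.
* [Kottwitz1986] R. Kottwitz, *Base change for unit elements of Hecke algebras*, Compositio Math. 60 (1986), §3.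
* [Tits1979] J. Tits, *Reductive groups over local fields*, PSPM 33.1 (1979), §3.5.
-/

set_option autoImplicit false

noncomputable section

open NumberField IsDedekindDomain MeasureTheory Measure Topology Filter Matrix ValuativeRel
open Literature.NumberTheory.Rogawski1990 Literature.NumberTheory.Automorphic Literature.NumberTheory.GaloisRepresentations
open Literature.NumberTheory.Automorphic.UnitaryGroup Literature.NumberTheory.Automorphic.IntegralReduction
open Literature.NumberTheory.Automorphic.UnitaryLatticeTree Literature.GroupTheory.SpecificGroups
open scoped Matrix MatrixGroups ValuativeRel

namespace Literature.NumberTheory.Rogawski1990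

section OrganB

set_option maxHeartbeats 800000 in
-- budget only: one statement-heavy declaration (the CM-place tokens); no search tactic runs long here.
/-- **Pointwise boundary split on a 2-deep class**: for a `K`-supported `g` with boundary values `c` (organ V), the level-1 strata piece `h`
with values `c` (`c 0 = 0`) and any `z` in the `G′_v`-class of a 2-deep `γ₀` (`γ₀,w ≡ 1 (ϖ_v²)`): `g z − h z = (1_{x_w ≡ 1 (ϖ_v)}·g) z`.
Off `K` all three vanish; on `K`, `χ_z = χ_{γ₀} ≡ (X − 1)³ (𝔪_w)` makes `red(z_w) − 1` nilpotent (★ `isNilpotent_redMat_conj_sub_one_of_charpoly`),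
of rank `0` (interior, ★ `rank_redMat_sub_one_eq_zero_iff_forall_valuation_le`: `g_int z = g z`, `h z = c 0 = 0`) or `1, 2` (boundary:
`g_int z = 0`, `g z = c s = h z`). [cite: Rogawski1990, §4.9 Prop. 4.9.1 p. 55; §3.9 p. 32] [cite: Kottwitz1986, §3] -/
theorem sub_apply_eq_indicator_apply_of_two_deep
    (L : Type) [Field L] [NumberField L] [IsCMField L] (H' : Matrix (Fin 3) (Fin 3) L)
    {v : HeightOneSpectrum (𝓞 ↥(maximalRealSubfield L))}
    (w : PlacesOver L v) (hw : IsCMField.complexConj L • w.1 = w.1) (hv : Algebra.IsUnramifiedIn (𝓞 L) v.asIdeal)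
    (g : ((cmDatum L 3 H').Local v) → ℂ) (hgK : tsupport g ⊆ (cmLocalIntegralLevel L 3 H' v : Set ((cmDatum L 3 H').Local v)))
    (c : ℕ → ℂ) (hc : (c 0 = 0 ∧ (∀ x : ((cmDatum L 3 H').Local v), (x ∈ cmLocalIntegralLevel L 3 H' v ∧ (redMat (((x).val : GL (Fin 3) (UnitaryGroup.LocalRing L v)).val.map (Pi.evalRingHom (fun w' : PlacesOver L v => w'.1.adicCompletion L) w)) - 1) ^ 3 = 0 ∧ (redMat (((x).val : GL (Fin 3) (UnitaryGroup.LocalRing L v)).val.map (Pi.evalRingHom (fun w' : PlacesOver L v => w'.1.adicCompletion L) w)) - 1).rank = 1 ∧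
        ∃ y : ((cmDatum L 3 H').Local v), (∀ a b, Valued.v (((toPlace v w (HeckeCharacter.uniformizer ↥(maximalRealSubfield L) v : v.adicCompletion ↥(maximalRealSubfield L))) ^ 2)⁻¹ *
        ((((localNonsplitEquiv (IsCMField.complexConj L) H' (IsCMField.complexConj_ne_one L) w hw (y * x * y⁻¹) :
            ↥(unitaryGroupOfForm (galAdicCompletionMap (L := L) (IsCMField.complexConj L) hw) (placeForm H' w.1))) : GL (Fin 3) (w.1.adicCompletion L)) :
              Matrix (Fin 3) (Fin 3) (w.1.adicCompletion L)) a b - (1 : Matrix (Fin 3) (Fin 3) (w.1.adicCompletion L)) a b)) ≤ 1)) → g x = c 1) ∧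
      (∀ x : ((cmDatum L 3 H').Local v), (x ∈ cmLocalIntegralLevel L 3 H' v ∧ (redMat (((x).val : GL (Fin 3) (UnitaryGroup.LocalRing L v)).val.map (Pi.evalRingHom (fun w' : PlacesOver L v => w'.1.adicCompletion L) w)) - 1) ^ 3 = 0 ∧ (redMat (((x).val : GL (Fin 3) (UnitaryGroup.LocalRing L v)).val.map (Pi.evalRingHom (fun w' : PlacesOver L v => w'.1.adicCompletion L) w)) - 1).rank = 2 ∧
        ∃ y : ((cmDatum L 3 H').Local v), (∀ a b, Valued.v (((toPlace v w (HeckeCharacter.uniformizer ↥(maximalRealSubfield L) v : v.adicCompletion ↥(maximalRealSubfield L))) ^ 2)⁻¹ *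
        ((((localNonsplitEquiv (IsCMField.complexConj L) H' (IsCMField.complexConj_ne_one L) w hw (y * x * y⁻¹) :
            ↥(unitaryGroupOfForm (galAdicCompletionMap (L := L) (IsCMField.complexConj L) hw) (placeForm H' w.1))) : GL (Fin 3) (w.1.adicCompletion L)) :
              Matrix (Fin 3) (Fin 3) (w.1.adicCompletion L)) a b - (1 : Matrix (Fin 3) (Fin 3) (w.1.adicCompletion L)) a b)) ≤ 1)) → g x = c 2)))
    (h : ((cmDatum L 3 H').Local v) → ℂ) (hhK : tsupport h ⊆ (cmLocalIntegralLevel L 3 H' v : Set ((cmDatum L 3 H').Local v)))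
    (hhval : ∀ k ∈ cmLocalIntegralLevel L 3 H' v,
        (redMat (((k).val : GL (Fin 3) (UnitaryGroup.LocalRing L v)).val.map (Pi.evalRingHom (fun w' : PlacesOver L v => w'.1.adicCompletion L) w)) - 1) ^ 3 = 0 →
        h k = c (redMat (((k).val : GL (Fin 3) (UnitaryGroup.LocalRing L v)).val.map (Pi.evalRingHom (fun w' : PlacesOver L v => w'.1.adicCompletion L) w)) - 1).rank)
    {γ₀ z : ((cmDatum L 3 H').Local v)} (hγ₀2 : (∀ a b, Valued.v (((toPlace v w (HeckeCharacter.uniformizer ↥(maximalRealSubfield L) v : v.adicCompletion ↥(maximalRealSubfield L))) ^ 2)⁻¹ * (((((localNonsplitEquiv (IsCMField.complexConj L) H' (IsCMField.complexConj_ne_one L) w hw γ₀) : ↥(unitaryGroupOfForm (galAdicCompletionMap (L := L) (IsCMField.complexConj L) hw) (placeForm H' w.1))) : GL (Fin 3) (w.1.adicCompletion L)) : Matrix (Fin 3) (Fin 3) (w.1.adicCompletion L)) a b - (1 : Matrix (Fin 3) (Fin 3) (w.1.adicCompletion L)) a b)) ≤ 1)) (hγz : ConjClasses.mk γ₀ =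 ConjClasses.mk z) :
    (g - h) z = Set.indicator {x : (cmDatum L 3 H').Local v | (∀ a b, Valued.v (((toPlace v w (HeckeCharacter.uniformizer ↥(maximalRealSubfield L) v : v.adicCompletion ↥(maximalRealSubfield L))) ^ 1)⁻¹ * (((((localNonsplitEquiv (IsCMField.complexConj L) H' (IsCMField.complexConj_ne_one L) w hw x) : ↥(unitaryGroupOfForm (galAdicCompletionMap (L := L) (IsCMField.complexConj L) hw) (placeForm H' w.1))) : GL (Fin 3) (w.1.adicCompletion L)) : Matrix (Fin 3) (Fin 3) (w.1.adicCompletion L)) a b - (1 : Matrix (Fin 3) (Fin 3) (w.1.adicCompletion L)) a b)) ≤ 1)} g z := by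
  classical
  have hc1 : IsCMField.complexConj L ≠ 1 := IsCMField.complexConj_ne_one L
  by_cases hzK : z ∈ (cmLocalIntegralLevel L 3 H' v)
  swap
  · have hgz : g z = 0 := image_eq_zero_of_notMem_tsupport (fun hz => hzK (hgK hz))
    have hhz : h z = 0 := image_eq_zero_of_notMem_tsupport (fun hz => hzK (hhK hz))
    rw [Pi.sub_apply, hgz, hhz, sub_zero, Set.indicator_apply_eq_zero.2 (fun _ => hgz)]
  obtain ⟨q, hq⟩ := isConj_iff.1 (ConjClasses.mk_eq_mk_iff_isConj.1 hγz)
  -- §0 the place `w`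
  have hϖv := Liu2021.LemD1IndexedNonVacuityInertCofinite.valued_toPlace_uniformizer_of_isUnramifiedIn L v hv w
  have hϖ : IsUniformizingElement (toPlace v w (HeckeCharacter.uniformizer ↥(maximalRealSubfield L) v : v.adicCompletion ↥(maximalRealSubfield L))) := isUniformizingElement_of_v_eq hϖv
  have hϖ0v : Valued.v (toPlace v w (HeckeCharacter.uniformizer ↥(maximalRealSubfield L) v : v.adicCompletion ↥(maximalRealSubfield L))) ≠ 0 := by rw [hϖv]; exact WithZero.coe_ne_zero
  have hϖ1 : Valued.v (toPlace v w (HeckeCharacter.uniformizer ↥(maximalRealSubfield L) v : v.adicCompletion ↥(maximalRealSubfield L))) < 1 := by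
    rw [hϖv, ← WithZero.exp_zero]; exact WithZero.exp_lt_exp.2 (by norm_num)
  have hϖ2le : Valued.v ((toPlace v w (HeckeCharacter.uniformizer ↥(maximalRealSubfield L) v : v.adicCompletion ↥(maximalRealSubfield L))) ^ 2) ≤ 1 := by rw [Valuation.map_pow]; exact pow_le_one₀ zero_le hϖ1.le
  have hϖ2lt : Valued.v ((toPlace v w (HeckeCharacter.uniformizer ↥(maximalRealSubfield L) v : v.adicCompletion ↥(maximalRealSubfield L))) ^ 2) < 1 := by rw [Valuation.map_pow]; exact pow_lt_one₀ zero_le hϖ1 two_ne_zero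
  have hϖ2ne : Valued.v ((toPlace v w (HeckeCharacter.uniformizer ↥(maximalRealSubfield L) v : v.adicCompletion ↥(maximalRealSubfield L))) ^ 2) ≠ 0 := by rw [Valuation.map_pow]; exact pow_ne_zero _ hϖ0v
  -- §1 opaque one-place images of `z, γ₀, q`
  obtain ⟨Z, hZ⟩ : ∃ X : GL (Fin 3) (w.1.adicCompletion L), X = (((localNonsplitEquiv (IsCMField.complexConj L) H' (IsCMField.complexConj_ne_one L) w hw z)).val : GL (Fin 3) (w.1.adicCompletion L)) := ⟨_, rfl⟩
  obtain ⟨Γ, hΓ⟩ : ∃ X : GL (Fin 3) (w.1.adicCompletion L), X = (((localNonsplitEquiv (IsCMField.complexConj L) H' (IsCMField.complexConj_ne_one L) w hw γ₀)).val : GL (Fin 3) (w.1.adicCompletion L)) := ⟨_, rfl⟩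
  obtain ⟨Qm, hQm⟩ : ∃ X : GL (Fin 3) (w.1.adicCompletion L), X = (((localNonsplitEquiv (IsCMField.complexConj L) H' (IsCMField.complexConj_ne_one L) w hw q)).val : GL (Fin 3) (w.1.adicCompletion L)) := ⟨_, rfl⟩
  have hZint : Z ∈ glInt 3 (w.1.adicCompletion L) := by
    rw [hZ]; exact (mem_localIntegralLevel_iff_of_smul_eq (IsCMField.complexConj L) 3 H' hc1 w hw z).1 hzK
  have he1 : (localNonsplitEquiv (IsCMField.complexConj L) H' (IsCMField.complexConj_ne_one L) w hw z) = (localNonsplitEquiv (IsCMField.complexConj L) H' (IsCMField.complexConj_ne_one L) w hw (q * γ₀)) * (localNonsplitEquiv (IsCMField.complexConj L) H' (IsCMField.complexConj_ne_one L) w hw q⁻¹) := by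
    rw [← hq]; exact map_mul _ _ _
  have he2 : (localNonsplitEquiv (IsCMField.complexConj L) H' (IsCMField.complexConj_ne_one L) w hw (q * γ₀)) = (localNonsplitEquiv (IsCMField.complexConj L) H' (IsCMField.complexConj_ne_one L) w hw q) * (localNonsplitEquiv (IsCMField.complexConj L) H' (IsCMField.complexConj_ne_one L) w hw γ₀) := map_mul _ _ _
  have he3 : (localNonsplitEquiv (IsCMField.complexConj L) H' (IsCMField.complexConj_ne_one L) w hw q⁻¹) = ((localNonsplitEquiv (IsCMField.complexConj L) H' (IsCMField.complexConj_ne_one L) w hw q))⁻¹ := map_inv _ _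
  have hZconj : Z = Qm⁻¹⁻¹ * Γ * Qm⁻¹ := by
    rw [inv_inv, hZ, hΓ, hQm, he1, he2, he3]; rfl
  -- §2 `χ_{γ₀} ≡ (X − 1)³ (𝔪_w)` and residual nilpotence of `z`
  have hΓ2 : IsIntMatrix (((toPlace v w (HeckeCharacter.uniformizer ↥(maximalRealSubfield L) v : v.adicCompletion ↥(maximalRealSubfield L))) ^ 2)⁻¹ • ((Γ : Matrix (Fin 3) (Fin 3) (w.1.adicCompletion L)) - 1)) := by
    rw [hΓ]; intro a b
    simpa only [Matrix.smul_apply, Matrix.sub_apply, smul_eq_mul] using hγ₀2 a b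
  have h1c : (1 : Matrix (Fin 3) (Fin 3) (w.1.adicCompletion L)).charpoly = (Polynomial.X - 1) ^ 3 := by
    rw [Matrix.charpoly_one, Fintype.card_fin]
  have hcoef : ∀ m : ℕ, valuation (w.1.adicCompletion L) ((((Γ : Matrix (Fin 3) (Fin 3) (w.1.adicCompletion L))).charpoly - (Polynomial.X - 1) ^ 3).coeff m) < 1 := by
    intro m
    have hle := v_inv_mul_charpoly_coeff_sub_le_one (A := (Γ : Matrix (Fin 3) (Fin 3) (w.1.adicCompletion L))) isIntMatrix_one hϖ2le hΓ2 m
    rw [Valuation.map_mul, map_inv₀] at hle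
    have key := mul_le_mul_right hle (Valued.v ((toPlace v w (HeckeCharacter.uniformizer ↥(maximalRealSubfield L) v : v.adicCompletion ↥(maximalRealSubfield L))) ^ 2))
    rw [← mul_assoc, mul_inv_cancel₀ hϖ2ne, one_mul, mul_one] at key
    refine (v_lt_one_iff_valuation_lt_one _).1 (lt_of_le_of_lt ?_ hϖ2lt)
    rw [← h1c, Polynomial.coeff_sub]; exact key
  have hnilZ : IsNilpotent (redMat (((Qm⁻¹⁻¹ * Γ * Qm⁻¹ : GL (Fin 3) (w.1.adicCompletion L))) : Matrix (Fin 3) (Fin 3) (w.1.adicCompletion L)) - 1) :=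
    isNilpotent_redMat_conj_sub_one_of_charpoly Γ Qm⁻¹ (by rw [← hZconj]; exact hZint) hcoef
  rw [← hZconj] at hnilZ
  have hMz : ((Z : GL (Fin 3) (w.1.adicCompletion L)) : Matrix (Fin 3) (Fin 3) (w.1.adicCompletion L)) = (((z).val : GL (Fin 3) (UnitaryGroup.LocalRing L v)).val.map (Pi.evalRingHom (fun w' : PlacesOver L v => w'.1.adicCompletion L) w)) := by
    rw [hZ]; exact coe_localNonsplitEquiv_apply L H' v w hw z
  obtain ⟨N, hN⟩ : ∃ N : Matrix (Fin 3) (Fin 3) 𝓀[(w.1.adicCompletion L)], N = redMat (((z).val : GL (Fin 3) (UnitaryGroup.LocalRing L v)).val.map (Pi.evalRingHom (fun w' : PlacesOver L v => w'.1.adicCompletion L) w)) - 1 := ⟨_, rfl⟩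
  have hnilN : IsNilpotent N := by rw [hN, ← hMz]; exact hnilZ
  have hnil3 : (redMat (((z).val : GL (Fin 3) (UnitaryGroup.LocalRing L v)).val.map (Pi.evalRingHom (fun w' : PlacesOver L v => w'.1.adicCompletion L) w)) - 1) ^ 3 = 0 := by
    rw [← hN]; exact (isNilpotent_iff_pow_three_eq_zero N).1 hnilN
  have hhz : h z = c N.rank := by rw [hN]; exact hhval z hzK hnil3
  -- §3 interior membership ↔ rank `0` (★ ROW-0 bridge)
  have hS_iff : z ∈ ({x : (cmDatum L 3 H').Local v | (∀ a b, Valued.v (((toPlace v w (HeckeCharacter.uniformizer ↥(maximalRealSubfield L) v : v.adicCompletion ↥(maximalRealSubfield L))) ^ 1)⁻¹ * (((((localNonsplitEquiv (IsCMField.complexConj L) H' (IsCMField.complexConj_ne_one L) w hw x) : ↥(unitaryGroupOfForm (galAdicCompletionMap (L := L) (IsCMField.complexConj L) hw) (placeForm H' w.1))) : GL (Fin 3) (w.1.adicCompletion L)) : Matrix (Fin 3) (Fin 3) (w.1.adicCompletion L)) a b - (1 : Matrix (Fin 3) (Fin 3) (w.1.adicCompletion L)) a b)) ≤ 1)} :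 Set ((cmDatum L 3 H').Local v)) ↔ N.rank = 0 := by
    rw [Set.mem_setOf_eq, hN, ← hMz, rank_redMat_sub_one_eq_zero_iff_forall_valuation_le hϖ hZint]
    constructor
    · intro ht i j
      apply (v_le_iff_valuation_le _ _).1
      have hij := ht i j
      rw [pow_one, Valuation.map_mul, map_inv₀] at hij
      have key := mul_le_mul_right hij (Valued.v (toPlace v w (HeckeCharacter.uniformizer ↥(maximalRealSubfield L) v : v.adicCompletion ↥(maximalRealSubfield L))))
      rw [← mul_assoc, mul_inv_cancel₀ hϖ0v, one_mul, mul_one] at key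
      rw [hZ, Matrix.sub_apply]; exact key
    · intro hr a b
      have hab := (v_le_iff_valuation_le _ _).2 (hr a b)
      rw [hZ, Matrix.sub_apply] at hab
      rw [pow_one, Valuation.map_mul, map_inv₀]
      have key := mul_le_mul_right hab (Valued.v (toPlace v w (HeckeCharacter.uniformizer ↥(maximalRealSubfield L) v : v.adicCompletion ↥(maximalRealSubfield L))))⁻¹
      rwa [inv_mul_cancel₀ hϖ0v] at key
  -- §4 the 2-deep witness for `z`: `q⁻¹ z q = γ₀`
  have hyz : q⁻¹ * z * q⁻¹⁻¹ = γ₀ := by rw [← hq]; group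
  have hBDz : ∃ y : ((cmDatum L 3 H').Local v), (∀ a b, Valued.v (((toPlace v w (HeckeCharacter.uniformizer ↥(maximalRealSubfield L) v : v.adicCompletion ↥(maximalRealSubfield L))) ^ 2)⁻¹ * (((((localNonsplitEquiv (IsCMField.complexConj L) H' (IsCMField.complexConj_ne_one L) w hw (y * z * y⁻¹)) : ↥(unitaryGroupOfForm (galAdicCompletionMap (L := L) (IsCMField.complexConj L) hw) (placeForm H' w.1))) : GL (Fin 3) (w.1.adicCompletion L)) : Matrix (Fin 3) (Fin 3) (w.1.adicCompletion L)) a b - (1 : Matrix (Fin 3) (Fin 3) (w.1.adicCompletion L)) a b)) ≤ 1) :=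
    ⟨q⁻¹, by rw [hyz]; exact hγ₀2⟩
  -- §5 the three ranks
  have hr_lt : N.rank < 3 := rank_lt_of_isNilpotent hnilN (by norm_num)
  rw [Pi.sub_apply]
  rcases (by omega : N.rank = 0 ∨ N.rank = 1 ∨ N.rank = 2) with hr | hr | hr
  · rw [Set.indicator_of_mem (hS_iff.2 hr), hhz, hr, hc.1, sub_zero]
  · have hzS : z ∉ ({x : (cmDatum L 3 H').Local v | (∀ a b, Valued.v (((toPlace v w (HeckeCharacter.uniformizer ↥(maximalRealSubfield L) v : v.adicCompletion ↥(maximalRealSubfield L))) ^ 1)⁻¹ * (((((localNonsplitEquiv (IsCMField.complexConj L) H' (IsCMField.complexConj_ne_one L) w hw x) : ↥(unitaryGroupOfForm (galAdicCompletionMap (L := L) (IsCMField.complexConj L) hw) (placeForm H' w.1))) : GL (Fin 3) (w.1.adicCompletion L)) : Matrix (Fin 3) (Fin 3) (w.1.adicCompletion L)) a b - (1 : Matrix (Fin 3) (Fin 3) (w.1.adicCompletion L)) a b)) ≤ 1)} : Set ((cmDatum L 3 H').Local v)) := fun hz => by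
      have h0 := hS_iff.1 hz; omega
    rw [Set.indicator_of_notMem hzS, hhz, hr]
    have hgz : g z = c 1 := hc.2.1 z ⟨hzK, hnil3, by rw [← hN]; exact hr, hBDz⟩
    rw [hgz, sub_self]
  · have hzS : z ∉ ({x : (cmDatum L 3 H').Local v | (∀ a b, Valued.v (((toPlace v w (HeckeCharacter.uniformizer ↥(maximalRealSubfield L) v : v.adicCompletion ↥(maximalRealSubfield L))) ^ 1)⁻¹ * (((((localNonsplitEquiv (IsCMField.complexConj L) H' (IsCMField.complexConj_ne_one L) w hw x) : ↥(unitaryGroupOfForm (galAdicCompletionMap (L := L) (IsCMField.complexConj L) hw) (placeForm H' w.1))) : GL (Fin 3) (w.1.adicCompletion L)) : Matrix (Fin 3) (Fin 3) (w.1.adicCompletion L)) a b - (1 : Matrix (Fin 3) (Fin 3) (w.1.adicCompletion L)) a b)) ≤ 1)} : Set ((cmDatum L 3 H').Local v)) := fun hz => by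
      have h0 := hS_iff.1 hz; omega
    rw [Set.indicator_of_notMem hzS, hhz, hr]
    have hgz : g z = c 2 := hc.2.2 z ⟨hzK, hnil3, by rw [← hN]; exact hr, hBDz⟩
    rw [hgz, sub_self]

set_option maxHeartbeats 800000 in
-- budget only: one statement-heavy declaration (the END's organ-B tokens); no search tactic runs long here.
/-- **ORGAN B «LIFT — BOUNDARY HALF»** (END fold v3.2 `stub_liftBoundary`, conclusion VERBATIM; binders = the used subset): given the
boundary values `c` of the level-2 `K`-class piece `g` (organ V), the level-1 strata piece `h` with values `c` (★ `exists_levelOne_piece_boundary`)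
satisfies, at every `G`-regular `γ_H` and under (H2D) «every `Δ‴(γ_H,·)`-support class meeting `K` contains a 2-deep `γ₀ ∈ K`»,
`Σᶠ_c Δ‴(γ_H,c)Φ(c,g) = Σᶠ_c Δ‴(γ_H,c)Φ(c,g_int) + Σᶠ_c Δ‴(γ_H,c)Φ(c,h)`: termwise `Φ(c,g) = Φ(c,(g−h)+h) = Φ(c,g−h) + Φ(c,h)` (additivity at the
regular class, ★ `classOrbitalIntegral_add_of_isLocSmooth_of_delta_ne_zero`) and `Φ(c,g−h) = Φ(c,g_int)` (★ `classOrbitalIntegral_congr_of_forall_conj`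
with `sub_apply_eq_indicator_apply_of_two_deep` on the orbit); finite supports ★ `finite_support_delta_mul_classOrbitalIntegral_of_isLocSmooth`.
(`V = univ`; the Levi guard is not used.) [cite: Rogawski1990, §4.9 Prop. 4.9.1 p. 55; §4.3 p. 43] [cite: Kottwitz1986, §3] -/
theorem liftBoundary_of_levelTwo
    (L : Type) [Field L] [NumberField L] [IsCMField L] (H' : Matrix (Fin 3) (Fin 3) L) (μ : HeckeCharacter L)
    {v : HeightOneSpectrum (𝓞 ↥(maximalRealSubfield L))}
    (hH' : (H'.map (cmConjRingHom L)).transpose = H') (w : PlacesOver L v)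
    (hw : IsCMField.complexConj L • w.1 = w.1) (hv : Algebra.IsUnramifiedIn (𝓞 L) v.asIdeal)
    (hH'w : IsUnit (placeForm H' w.1))
    [MeasurableSpace ((cmDatum L 3 H').Local v)] [BorelSpace ((cmDatum L 3 H').Local v)]
    [∀ γ : ((cmDatum L 3 H').Local v), MeasurableSpace (((cmDatum L 3 H').Local v) ⧸ Subgroup.centralizer ({γ} : Set ((cmDatum L 3 H').Local v)))]
    [∀ γ : ((cmDatum L 3 H').Local v), BorelSpace (((cmDatum L 3 H').Local v) ⧸ Subgroup.centralizer ({γ} : Set ((cmDatum L 3 H').Local v)))]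
    (νG : Measure ((cmDatum L 3 H').Local v)) [νG.IsHaarMeasure] [νG.IsMulRightInvariant]
    {mG : OrbitalMeasureFamily ((cmDatum L 3 H').Local v)}
    (hmG : mG.IsCanonical (fun γ => IsRegularElt (γ.val : GL (Fin 3) (UnitaryGroup.LocalRing L v))) νG)
    (g : ((cmDatum L 3 H').Local v) → ℂ) (hg : IsLocSmooth g) (hgK : tsupport g ⊆ (cmLocalIntegralLevel L 3 H' v : Set ((cmDatum L 3 H').Local v)))
    (c : ℕ → ℂ) (hc : (c 0 = 0 ∧ (∀ x : ((cmDatum L 3 H').Local v), (x ∈ cmLocalIntegralLevel L 3 H' v ∧ (redMat (((x).val : GL (Fin 3) (UnitaryGroup.LocalRing L v)).val.map (Pi.evalRingHom (fun w' : PlacesOver L v => w'.1.adicCompletion L) w)) - 1) ^ 3 = 0 ∧ (redMat (((x).val : GL (Fin 3) (UnitaryGroup.LocalRing L v)).val.map (Pi.evalRingHom (fun w' : PlacesOver L v => w'.1.adicCompletion L) w)) - 1).rank = 1 ∧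
        ∃ y : ((cmDatum L 3 H').Local v), (∀ a b, Valued.v (((toPlace v w (HeckeCharacter.uniformizer ↥(maximalRealSubfield L) v : v.adicCompletion ↥(maximalRealSubfield L))) ^ 2)⁻¹ *
        ((((localNonsplitEquiv (IsCMField.complexConj L) H' (IsCMField.complexConj_ne_one L) w hw (y * x * y⁻¹) :
            ↥(unitaryGroupOfForm (galAdicCompletionMap (L := L) (IsCMField.complexConj L) hw) (placeForm H' w.1))) : GL (Fin 3) (w.1.adicCompletion L)) :
              Matrix (Fin 3) (Fin 3) (w.1.adicCompletion L)) a b - (1 : Matrix (Fin 3) (Fin 3) (w.1.adicCompletion L)) a b)) ≤ 1)) → g x = c 1) ∧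
      (∀ x : ((cmDatum L 3 H').Local v), (x ∈ cmLocalIntegralLevel L 3 H' v ∧ (redMat (((x).val : GL (Fin 3) (UnitaryGroup.LocalRing L v)).val.map (Pi.evalRingHom (fun w' : PlacesOver L v => w'.1.adicCompletion L) w)) - 1) ^ 3 = 0 ∧ (redMat (((x).val : GL (Fin 3) (UnitaryGroup.LocalRing L v)).val.map (Pi.evalRingHom (fun w' : PlacesOver L v => w'.1.adicCompletion L) w)) - 1).rank = 2 ∧
        ∃ y : ((cmDatum L 3 H').Local v), (∀ a b, Valued.v (((toPlace v w (HeckeCharacter.uniformizer ↥(maximalRealSubfield L) v : v.adicCompletion ↥(maximalRealSubfield L))) ^ 2)⁻¹ *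
        ((((localNonsplitEquiv (IsCMField.complexConj L) H' (IsCMField.complexConj_ne_one L) w hw (y * x * y⁻¹) :
            ↥(unitaryGroupOfForm (galAdicCompletionMap (L := L) (IsCMField.complexConj L) hw) (placeForm H' w.1))) : GL (Fin 3) (w.1.adicCompletion L)) :
              Matrix (Fin 3) (Fin 3) (w.1.adicCompletion L)) a b - (1 : Matrix (Fin 3) (Fin 3) (w.1.adicCompletion L)) a b)) ≤ 1)) → g x = c 2))) :
    ∃ h : ((cmDatum L 3 H').Local v) → ℂ, IsLocSmooth h ∧ tsupport h ⊆ (cmLocalIntegralLevel L 3 H' v : Set ((cmDatum L 3 H').Local v)) ∧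
      (∀ u ∈ cmLocalIntegralLevel L 3 H' v, ∀ x, h (u * x * u⁻¹) = h x) ∧
      (∀ k ∈ cmLocalIntegralLevel L 3 H' v,
        (redMat (((k).val : GL (Fin 3) (UnitaryGroup.LocalRing L v)).val.map (Pi.evalRingHom (fun w' : PlacesOver L v => w'.1.adicCompletion L) w)) - 1) ^ 3 = 0 →
        h k = c (redMat (((k).val : GL (Fin 3) (UnitaryGroup.LocalRing L v)).val.map (Pi.evalRingHom (fun w' : PlacesOver L v => w'.1.adicCompletion L) w)) - 1).rank) ∧
      ∃ V ∈ 𝓝 (1 : ((cmDatum L 2 (Matrix.of fun i j : Fin 2 => if i.val + j.val + 1 = 2 then (1 : L) else 0)).Local v × (cmDatum L 1 (Matrix.of fun i j : Fin 1 => if i.val + j.val + 1 = 1 then (1 : L) else 0)).Local v)), ∀ γH ∈ V, IsLocalGRegular L v γH →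
        ¬ (∃ (y : ((cmDatum L 2 (Matrix.of fun i j : Fin 2 => if i.val + j.val + 1 = 2 then (1 : L) else 0)).Local v × (cmDatum L 1 (Matrix.of fun i j : Fin 1 => if i.val + j.val + 1 = 1 then (1 : L) else 0)).Local v)) (d' : Fin 2 → (UnitaryGroup.LocalRing L v)ˣ),
          glDiagonal 2 (UnitaryGroup.LocalRing L v) d' = ((y * γH * y⁻¹).1.val : GL (Fin 2) (UnitaryGroup.LocalRing L v))) →
        (∀ cG : ConjClasses ((cmDatum L 3 H').Local v),
          ((finExplicitCollection L H' μ (finExplicitDelta_conj_left_all L H' μ) (finExplicitDelta_conj_right_all L H' μ)) v).Δ γH (Quotient.out cG) ≠ 0 →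
          (∃ z ∈ cmLocalIntegralLevel L 3 H' v, ConjClasses.mk z = cG) →
          ∃ γ₀ : ((cmDatum L 3 H').Local v), ConjClasses.mk γ₀ = cG ∧ γ₀ ∈ cmLocalIntegralLevel L 3 H' v ∧
            (∀ a b, Valued.v (((toPlace v w (HeckeCharacter.uniformizer ↥(maximalRealSubfield L) v : v.adicCompletion ↥(maximalRealSubfield L))) ^ 2)⁻¹ *
        ((((localNonsplitEquiv (IsCMField.complexConj L) H' (IsCMField.complexConj_ne_one L) w hw (γ₀) :
            ↥(unitaryGroupOfForm (galAdicCompletionMap (L := L) (IsCMField.complexConj L) hw) (placeForm H' w.1))) : GL (Fin 3) (w.1.adicCompletion L)) :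
              Matrix (Fin 3) (Fin 3) (w.1.adicCompletion L)) a b - (1 : Matrix (Fin 3) (Fin 3) (w.1.adicCompletion L)) a b)) ≤ 1)) →
        (∑ᶠ cG : ConjClasses ((cmDatum L 3 H').Local v),
            ((finExplicitCollection L H' μ (finExplicitDelta_conj_left_all L H' μ) (finExplicitDelta_conj_right_all L H' μ)) v).Δ γH (Quotient.out cG) *
              classOrbitalIntegral mG g cG) =
          (∑ᶠ cG : ConjClasses ((cmDatum L 3 H').Local v),
            ((finExplicitCollection L H' μ (finExplicitDelta_conj_left_all L H' μ) (finExplicitDelta_conj_right_all L H' μ)) v).Δ γH (Quotient.out cG) *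
              classOrbitalIntegral mG ({x : (cmDatum L 3 H').Local v | (∀ a b, Valued.v (((toPlace v w (HeckeCharacter.uniformizer ↥(maximalRealSubfield L) v : v.adicCompletion ↥(maximalRealSubfield L))) ^ 1)⁻¹ *
        ((((localNonsplitEquiv (IsCMField.complexConj L) H' (IsCMField.complexConj_ne_one L) w hw (x) :
            ↥(unitaryGroupOfForm (galAdicCompletionMap (L := L) (IsCMField.complexConj L) hw) (placeForm H' w.1))) : GL (Fin 3) (w.1.adicCompletion L)) :
              Matrix (Fin 3) (Fin 3) (w.1.adicCompletion L)) a b - (1 : Matrix (Fin 3) (Fin 3) (w.1.adicCompletion L)) a b)) ≤ 1)}.indicator g) cG) +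
          (∑ᶠ cG : ConjClasses ((cmDatum L 3 H').Local v),
            ((finExplicitCollection L H' μ (finExplicitDelta_conj_left_all L H' μ) (finExplicitDelta_conj_right_all L H' μ)) v).Δ γH (Quotient.out cG) *
              classOrbitalIntegral mG h cG) := by
  classical
  obtain ⟨h, hh, hhK, hhinv, -, hhval⟩ := exists_levelOne_piece_boundary L H' w hw hv c
  refine ⟨h, hh, hhK, hhinv, hhval, Set.univ, Filter.univ_mem, ?_⟩
  intro γH _ hreg _ hH2D
  -- the transfer factor `Δ‴_v` as a ★ `LocalTransferFactor`, the non-degeneracy of `H′`, admissibility of `m_G`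
  obtain ⟨T, hT⟩ : ∃ T : LocalTransferFactor L H' v, T = ((finExplicitCollection L H' μ (finExplicitDelta_conj_left_all L H' μ) (finExplicitDelta_conj_right_all L H' μ)) v) := ⟨_, rfl⟩
  rw [← hT] at hH2D ⊢
  have hdet' : H'.det ≠ 0 := by
    intro h0
    have h1 : IsUnit (algebraMap L (w.1.adicCompletion L) H'.det) := by
      rw [RingHom.map_det, RingHom.mapMatrix_apply]; exact (Matrix.isUnit_iff_isUnit_det _).1 hH'w
    rw [h0, map_zero] at h1
    exact not_isUnit_zero h1
  have hmG' : mG.IsAdmissibleOn fun γ' => IsRegularElt (γ'.val : GL (Fin 3) (UnitaryGroup.LocalRing L v)) := hmG.isAdmissibleOn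
  have hgh : IsLocSmooth (g - h) := hg.sub hh
  -- termwise: `Φ(c, g − h) = Φ(c, g_int)` on the `Δ‴`-support
  have hΦ : ∀ cG : ConjClasses ((cmDatum L 3 H').Local v), T.Δ γH (Quotient.out cG) ≠ 0 →
      classOrbitalIntegral mG (g - h) cG = classOrbitalIntegral mG (Set.indicator {x : (cmDatum L 3 H').Local v | (∀ a b, Valued.v (((toPlace v w (HeckeCharacter.uniformizer ↥(maximalRealSubfield L) v : v.adicCompletion ↥(maximalRealSubfield L))) ^ 1)⁻¹ * (((((localNonsplitEquiv (IsCMField.complexConj L) H' (IsCMField.complexConj_ne_one L) w hw x) : ↥(unitaryGroupOfForm (galAdicCompletionMap (L := L) (IsCMField.complexConj L) hw) (placeForm H' w.1))) : GL (Fin 3) (w.1.adicCompletion L)) : Matrix (Fin 3) (Fin 3) (w.1.adicCompletion L)) a b - (1 : Matrix (Fin 3) (Fin 3) (w.1.adicCompletion L)) a b)) ≤ 1)} g) cG := by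
    intro cG hΔ
    refine classOrbitalIntegral_congr_of_forall_conj mG cG fun x => ?_
    have hzc : ConjClasses.mk (x * Quotient.out cG * x⁻¹) = cG := by
      rw [← ConjClasses.mk_eq_mk_iff_isConj.2 (isConj_iff.2 ⟨x, rfl⟩)]; exact Quotient.out_eq cG
    by_cases hzK : x * Quotient.out cG * x⁻¹ ∈ (cmLocalIntegralLevel L 3 H' v)
    · obtain ⟨γ₀, hγ₀c, -, hγ₀2⟩ := hH2D cG hΔ ⟨_, hzK, hzc⟩
      exact sub_apply_eq_indicator_apply_of_two_deep L H' w hw hv g hgK c hc h hhK hhval hγ₀2 (hγ₀c.trans hzc.symm)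
    · have hgz : g (x * Quotient.out cG * x⁻¹) = 0 := image_eq_zero_of_notMem_tsupport (fun hz => hzK (hgK hz))
      have hhz : h (x * Quotient.out cG * x⁻¹) = 0 := image_eq_zero_of_notMem_tsupport (fun hz => hzK (hhK hz))
      rw [Pi.sub_apply, hgz, hhz, sub_zero, Set.indicator_apply_eq_zero.2 (fun _ => hgz)]
  have hterm : ∀ cG : ConjClasses ((cmDatum L 3 H').Local v), T.Δ γH (Quotient.out cG) * classOrbitalIntegral mG g cG =
      T.Δ γH (Quotient.out cG) * classOrbitalIntegral mG (Set.indicator {x : (cmDatum L 3 H').Local v | (∀ a b, Valued.v (((toPlace v w (HeckeCharacter.uniformizer ↥(maximalRealSubfield L) v : v.adicCompletion ↥(maximalRealSubfield L))) ^ 1)⁻¹ * (((((localNonsplitEquiv (IsCMField.complexConj L) H' (IsCMField.complexConj_ne_one L) w hw x) : ↥(unitaryGroupOfForm (galAdicCompletionMap (L := L) (IsCMField.complexConj L) hw) (placeForm H' w.1))) : GL (Fin 3) (w.1.adicCompletion L)) : Matrix (Fin 3) (Fin 3) (w.1.adicCompletion L)) a b - (1 : Matrix (Fin 3) (Fin 3)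 (w.1.adicCompletion L)) a b)) ≤ 1)} g) cG +
        T.Δ γH (Quotient.out cG) * classOrbitalIntegral mG h cG := by
    intro cG
    by_cases hΔ : T.Δ γH (Quotient.out cG) = 0
    · rw [hΔ, zero_mul, zero_mul, zero_mul, add_zero]
    have h1 : classOrbitalIntegral mG g cG = classOrbitalIntegral mG ((g - h) + h) cG := by rw [sub_add_cancel]
    have h2 : classOrbitalIntegral mG ((g - h) + h) cG = classOrbitalIntegral mG (g - h) cG + classOrbitalIntegral mG h cG :=
      classOrbitalIntegral_add_of_isLocSmooth_of_delta_ne_zero L H' v hH' hdet' T hmG' γH hreg cG hΔ (g - h) h hgh hh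
    rw [h1, h2, hΦ cG hΔ, mul_add]
  -- finite supports and the `Σᶠ` split
  have hfin1 := finite_support_delta_mul_classOrbitalIntegral_of_isLocSmooth L H' v hH' hdet' T mG (g - h) hgh γH hreg
  have hfin2 := finite_support_delta_mul_classOrbitalIntegral_of_isLocSmooth L H' v hH' hdet' T mG h hh γH hreg
  have hfin1' : (Function.support fun cG : ConjClasses ((cmDatum L 3 H').Local v) =>
      T.Δ γH (Quotient.out cG) * classOrbitalIntegral mG (Set.indicator {x : (cmDatum L 3 H').Local v | (∀ a b, Valued.v (((toPlace v w (HeckeCharacter.uniformizer ↥(maximalRealSubfield L) v : v.adicCompletion ↥(maximalRealSubfield L))) ^ 1)⁻¹ * (((((localNonsplitEquiv (IsCMField.complexConj L) H' (IsCMField.complexConj_ne_one L) w hw x) : ↥(unitaryGroupOfForm (galAdicCompletionMap (L := L) (IsCMField.complexConj L) hw) (placeForm H' w.1))) : GL (Fin 3) (w.1.adicCompletion L)) : Matrix (Fin 3) (Fin 3) (w.1.adicCompletion L)) a b - (1 : Matrix (Fin 3) (Fin 3) (w.1.adicCompletion L)) a b)) ≤ 1)} g) cG).Finite := by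
    refine hfin1.subset fun cG hcG => ?_
    rw [Function.mem_support] at hcG ⊢
    by_cases hΔ : T.Δ γH (Quotient.out cG) = 0
    · rw [hΔ, zero_mul] at hcG; exact (hcG rfl).elim
    · rw [hΦ cG hΔ]; exact hcG
  rw [finsum_congr hterm, finsum_add_distrib hfin1' hfin2]

end OrganB

end Literature.NumberTheory.Rogawski1990
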